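import Summits.QuantumFields.YangMills.Theorems.LuscherReductionDressedRitzLiftLeakageAllBases
import HarnessLib

/-!
# Crux `DressedRitz` (stmt-QuantumFields-20205), line «polyakovlift», stub S-LEAK `stub_liftLeakage` — support VII:
# the `∀`-basis reduction for ANY linear physical lift — in particular for the TIME-DRESSED lifts `K_β^m u` of the reshape r3

Support module (fleet seat ym-20205-polyakovlift-s1; `--supports stmt-QuantumFields-20205`, helper, no closure claim).  Part IV
(`LiftLeak.residualLaw_allBases_of_reference`) is keyed to the r2 lift `g ↦ liftVec β φ g`.  The lead's one-loop hazard memo (evidence #27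
`HAZARD-S-LEAK-UV.md`, confirming this seat's located finding F4) shows that the SHARP-TIME lift carries two-hard-gluon states of relative weight
`≍ κλ⁴/L`, fatal for (o4) at `Cλ³/L²`; the owner-endorsed repair (W1, reshape r3) TIME-DRESSES the lift: `u_i' = K_β^{m} u_i`, `m = dressSteps L = L`
(`dressedLiftVec β φ g := (transferApply β)^[dressSteps L] (liftVec β φ g)`, proposed tree file `…PolyakovLiftDressed.lean`).  The reduction of Part IV
uses only two properties of the lift — LINEARITY in the one-site function and PHYSICALITY — so it is stated here for an ARBITRARY such lift and
instantiated for every iterate `K_β^m ∘ liftVec β φ` (`m = 0` is Part IV; `m = dressSteps L` is r3's dressed family, definitionally):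

* ★★ `residualLaw_allBases_of_reference_lift`: for any `lift : (one-site functions) → (fine functions)` that is linear on physical families and maps
  physical to physical: reference residual law (RL, cluster-constant approximate eigenvalue) + in-cluster Gram control (GR) for the reference images
  `lift (ψ_n/Ω₁)` ⟹ `∃ a, ‖K_β (lift g_i) − a·lift g_i‖² ≤ 2Nρ‖lift g_i‖²` for EVERY lift basis `(ω, g)`;
* `iterate_liftVec_sum_smul`, `isPhys_iterate_liftVec`: `g ↦ K_β^m (liftVec β φ g)` is linear and physical;
* ★★ `residualLaw_allBases_of_reference_iterate m`: the instance for the time-dressed lifts `K_β^m (liftVec β φ g_i)`, every `m : ℕ`.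

HONEST FRAMING: fixed-lattice bookkeeping on the conditional femto rung R2b1; (RL) and (GR) are OPEN RG estimates (for the dressed family they are
the line's r3 content); the stub stays OPEN; nothing here bears on infinite volume, the continuum limit or the Clay gap.
References: M. Lüscher, NPB 219 (1983) 233 [cite: Luscher1983, §3]; Lüscher–Wolff, NPB 339 (1990) 222 [cite: LuscherWolff1990];
Reed–Simon IV Thm XIII.1 [cite: ReedSimonIV1978]; T. Kato (1949) [cite: Kato1949, §1].
-/

set_option autoImplicit false

noncomputable section

open MeasureTheory Filter Topology Real Finset
open Literature.MathematicalPhysics.QuantumFieldTheory (GaugeConfig Site gaugeTransform)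
open scoped BigOperators

namespace Summit.QuantumFields.YangMills.Theorems.FemtoTransferGap.LiftLeak

open Summit.QuantumFields.YangMills.Theorems.FemtoTransferGap
open Summit.QuantumFields.YangMills.Theorems.FemtoTransferGap.PolyakovLift
open Summit.QuantumFields.YangMills.Theorems.FemtoTransferGap.VacDict

variable {L : ℕ} [NeZero L]

/-- ★★ **Residual law for EVERY lift basis from one reference family — for ANY linear physical lift.**  `lift` maps one-site functions to fine
functions, is linear on finite physical families (`lift (Σ c_n f_n) = Σ c_n • lift f_n`) and maps physical to physical.  Reference data at the one-site
coupling `B > 0`: positive raw vacuum `Ω₁`, exact physical orthonormal eigenfamily `ψ_0 … ψ_{N−1}` (levels `λ_n`) dominating at `0 ≤ Λ < μ_k(B)`;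
reference images `v_n = lift (ψ_n/Ω₁)`.  IF (RL) `‖K_β v_n − a(λ_n)·v_n‖² ≤ ρ‖v_n‖²` (cluster-constant `a`) and (GR) `|⟨v_n,v_m⟩| ≤ γ‖v_n‖‖v_m‖`
(`n ≠ m`, `λ_n = λ_m`), `Nγ ≤ 1/2`, THEN every lift basis `(ω, g)` at `B` has `∃ a, ‖K_β(lift g_i) − a·lift g_i‖² ≤ 2Nρ‖lift g_i‖²`.
[cite: Luscher1983, §3] [cite: ReedSimonIV1978, Thm XIII.1] [cite: Kato1949, §1] -/
theorem residualLaw_allBases_of_reference_lift (β : ℝ)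
    (lift : (GaugeConfig 3 1 SU2 → ℝ) → (GaugeConfig 3 L SU2 → ℝ))
    (hlin : ∀ {N : ℕ} (f : Fin N → (GaugeConfig 3 1 SU2 → ℝ)) (c : Fin N → ℝ), (∀ n, IsPhys (f n)) →
      lift (fun V => ∑ n, c n * f n V) = ∑ n, c n • lift (f n))
    (hphys : ∀ g : GaugeConfig 3 1 SU2 → ℝ, IsPhys g → IsPhys (lift g))
    {B : ℝ} (hB : 0 < B) (k : ℕ)
    {Ω₁ : GaugeConfig 3 1 SU2 → ℝ} (hΩ₁ : IsRawVacuum B Ω₁) (hpos : ∃ c : ℝ, 0 < c ∧ ∀ V, c ≤ Ω₁ V)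
    {N : ℕ} {ψ : Fin N → (GaugeConfig 3 1 SU2 → ℝ)} (hψ : ∀ n, IsPhys (ψ n))
    (hon : ∀ n m, l2 (ψ n) (ψ m) = if n = m then 1 else 0) (ev : Fin N → ℝ) (heig : ∀ n, transferApply B (ψ n) = ev n • ψ n)
    {Λ : ℝ} (hΛ : 0 ≤ Λ) (hΛk : Λ < levelValue su2Rep 1 B k)
    (hdom : ∀ χ : GaugeConfig 3 1 SU2 → ℝ, IsPhys χ → (∀ n, l2 χ (ψ n) = 0) → l2 χ (transferApply B χ) ≤ Λ * l2 χ χ)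
    (a : ℝ → ℝ) {ρ γ : ℝ} (hρ : 0 ≤ ρ) (hγ : 0 ≤ γ) (hNγ : (N : ℝ) * γ ≤ 1 / 2)
    (hres : ∀ n, l2 (transferApply β (lift (ψ n / Ω₁)) - a (ev n) • lift (ψ n / Ω₁))
        (transferApply β (lift (ψ n / Ω₁)) - a (ev n) • lift (ψ n / Ω₁)) ≤ ρ * l2 (lift (ψ n / Ω₁)) (lift (ψ n / Ω₁)))
    (hgram : ∀ n m, n ≠ m → ev n = ev m →
      |l2 (lift (ψ n / Ω₁)) (lift (ψ m / Ω₁))| ≤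
        γ * (Real.sqrt (l2 (lift (ψ n / Ω₁)) (lift (ψ n / Ω₁))) * Real.sqrt (l2 (lift (ψ m / Ω₁)) (lift (ψ m / Ω₁)))))
    {ω : GaugeConfig 3 1 SU2 → ℝ} {g : Fin k → (GaugeConfig 3 1 SU2 → ℝ)} (hb : LiftBasis B k ω g) (i : Fin k) :
    ∃ a' : ℝ, l2 (transferApply β (lift (g i)) - a' • lift (g i)) (transferApply β (lift (g i)) - a' • lift (g i)) ≤
      2 * N * ρ * l2 (lift (g i)) (lift (g i)) := by
  classical
  obtain ⟨c₁, hc₁, hc₁le⟩ := hpos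
  have hω : ω = Ω₁ := liftBasis_ground_eq hb hΩ₁ ⟨c₁, hc₁, hc₁le⟩
  obtain ⟨hωp, -, -, -, hg, ⟨σ, hσ⟩, -⟩ := hb
  set μ : ℝ := levelValue su2Rep 1 B ((σ i : ℕ) + 1) with hμ
  have hμk : levelValue su2Rep 1 B k ≤ μ := levelValue_le_of_le (L := 1) hB (Nat.succ_le_of_lt (σ i).isLt)
  have hΛμ : Λ < μ := hΛk.trans_le hμk
  have hgω : IsPhys (g i * ω) := OpPlat.isPhys_mul (hg i) hωp
  obtain ⟨hcls, hexp⟩ := eq_sum_of_eigen_of_dominating (M := 1) B hψ hon ev heig hΛ hdom hgω hΛμ (hσ i)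
  set c : Fin N → ℝ := fun n => l2 (g i * ω) (ψ n) with hc
  have hf : ∀ n, IsPhys (ψ n / Ω₁) := fun n => OpPlat.isPhys_div (hψ n) hΩ₁.1 hc₁ hc₁le
  have hgi : g i = fun V => ∑ n, c n * (ψ n / Ω₁) V := by
    funext V
    have hΩV : Ω₁ V ≠ 0 := (hc₁.trans_le (hc₁le V)).ne'
    have h := hexp V
    have hωV : ω V = Ω₁ V := by rw [hω]
    rw [Pi.mul_apply, hωV] at h
    have : g i V = (∑ n, c n * ψ n V) / Ω₁ V := by rw [← h, mul_div_cancel_right₀ _ hΩV]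
    rw [this, Finset.sum_div]
    exact sum_congr rfl fun n _ => by rw [Pi.div_apply, mul_div_assoc]
  have hu : lift (g i) = ∑ n, c n • lift (ψ n / Ω₁) := by rw [hgi, hlin _ c hf]
  set V : Fin N → physSubmodule L := fun n => ⟨lift (ψ n / Ω₁), hphys _ (hf n)⟩ with hV
  set T : physSubmodule L →ₗ[ℝ] physSubmodule L := transferOp β - a μ • LinearMap.id with hT
  have hTcoe : ∀ y : physSubmodule L, ((T y : physSubmodule L) : GaugeConfig 3 L SU2 → ℝ) =
      transferApply β (y : GaugeConfig 3 L SU2 → ℝ) - a μ • (y : GaugeConfig 3 L SU2 → ℝ) := fun y => by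
    simp only [hT, LinearMap.sub_apply, LinearMap.smul_apply, LinearMap.id_apply, Submodule.coe_sub, Submodule.coe_smul,
      coe_transferOp]
  have hsupp : ∀ n, c n ≠ 0 → ev n = μ := fun n hn => by
    by_contra h; exact hn (hcls n h)
  have hres' : ∀ n, c n ≠ 0 → l2Form L (T (V n)) (T (V n)) ≤ ρ * l2Form L (V n) (V n) := by
    intro n hn
    rw [l2Form_apply, l2Form_apply, hTcoe]
    simpa only [hV, Submodule.coe_mk, hsupp n hn] using hres n
  have hgram' : ∀ n m, n ≠ m → c n ≠ 0 → c m ≠ 0 →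
      |l2Form L (V n) (V m)| ≤ γ * (Real.sqrt (l2Form L (V n) (V n)) * Real.sqrt (l2Form L (V m) (V m))) := by
    intro n m hnm hn hm
    simpa only [l2Form_apply, hV, Submodule.coe_mk] using hgram n m hnm ((hsupp n hn).trans (hsupp m hm).symm)
  have hmain := residual_sum_le (l2Form L) l2Form_symm l2Form_self_nonneg T V c hρ hγ hNγ hres' hgram'
  have hwcoe : ((∑ n, c n • V n : physSubmodule L) : GaugeConfig 3 L SU2 → ℝ) = lift (g i) := by
    rw [hu]; simp only [Submodule.coe_sum, Submodule.coe_smul, hV]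
  refine ⟨a μ, ?_⟩
  rw [l2Form_apply, l2Form_apply, hTcoe, hwcoe] at hmain
  exact hmain

/-- **Time-dressed lifts are physical**: `K_β^m (liftVec β φ g)` is physical for physical `φ`, `g`. [cite: LuscherWolff1990] -/
theorem isPhys_iterate_liftVec (β : ℝ) (m : ℕ) {φ : GaugeConfig 3 L SU2 → ℝ} (hφ : IsPhys φ) {g : GaugeConfig 3 1 SU2 → ℝ}
    (hg : IsPhys g) : IsPhys ((transferApply (L := L) β)^[m] (liftVec β φ g)) :=
  isPhys_iterate_transferApply β (isPhys_liftVec β hφ hg) m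

/-- **Time-dressed lifts are linear in the one-site function**: `K_β^m (liftVec β φ (Σ c_n f_n)) = Σ c_n • K_β^m (liftVec β φ f_n)` (physical `φ`, `f_n`).
[folklore] -/
theorem iterate_liftVec_sum_smul (β : ℝ) (m : ℕ) {φ : GaugeConfig 3 L SU2 → ℝ} (hφ : IsPhys φ) {N : ℕ}
    {f : Fin N → (GaugeConfig 3 1 SU2 → ℝ)} (hf : ∀ n, IsPhys (f n)) (c : Fin N → ℝ) :
    (transferApply (L := L) β)^[m] (liftVec β φ (fun V => ∑ n, c n * f n V)) =
      ∑ n, c n • (transferApply (L := L) β)^[m] (liftVec β φ (f n)) := by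
  rw [liftVec_sum_smul β hφ hf c]
  set W : Fin N → physSubmodule L := fun n => ⟨liftVec β φ (f n), isPhys_liftVec β hφ (hf n)⟩ with hW
  have hsum : (∑ n, c n • liftVec β φ (f n)) = ((∑ n, c n • W n : physSubmodule L) : GaugeConfig 3 L SU2 → ℝ) := by
    simp only [Submodule.coe_sum, Submodule.coe_smul, hW]
  rw [hsum, ← coe_iterOp, map_sum]
  simp only [map_smul, Submodule.coe_sum, Submodule.coe_smul, coe_iterOp, hW]

/-- ★★ **Residual law for EVERY lift basis, TIME-DRESSED version** (`m : ℕ` arbitrary; `m = 0` is Part IV, `m = dressSteps L = L` is the reshape r3's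
dressed family `dressedLiftVec β φ g = (transferApply β)^[dressSteps L] (liftVec β φ g)`, definitionally).  Reference images `v_n = K_β^m(liftVec β φ (ψ_n/Ω₁))`;
(RL) with a cluster-constant approximate eigenvalue + (GR) for them ⟹ `∃ a, ‖K_β u_i' − a·u_i'‖² ≤ 2Nρ‖u_i'‖²`, `u_i' = K_β^m(liftVec β φ g_i)`, for every
lift basis `(ω, g)`. [cite: Luscher1983, §3] [cite: LuscherWolff1990] [cite: Kato1949, §1] -/
theorem residualLaw_allBases_of_reference_iterate (β : ℝ) (m : ℕ) {φ : GaugeConfig 3 L SU2 → ℝ} (hφ : IsPhys φ)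
    {B : ℝ} (hB : 0 < B) (k : ℕ)
    {Ω₁ : GaugeConfig 3 1 SU2 → ℝ} (hΩ₁ : IsRawVacuum B Ω₁) (hpos : ∃ c : ℝ, 0 < c ∧ ∀ V, c ≤ Ω₁ V)
    {N : ℕ} {ψ : Fin N → (GaugeConfig 3 1 SU2 → ℝ)} (hψ : ∀ n, IsPhys (ψ n))
    (hon : ∀ n m, l2 (ψ n) (ψ m) = if n = m then 1 else 0) (ev : Fin N → ℝ) (heig : ∀ n, transferApply B (ψ n) = ev n • ψ n)
    {Λ : ℝ} (hΛ : 0 ≤ Λ) (hΛk : Λ < levelValue su2Rep 1 B k)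
    (hdom : ∀ χ : GaugeConfig 3 1 SU2 → ℝ, IsPhys χ → (∀ n, l2 χ (ψ n) = 0) → l2 χ (transferApply B χ) ≤ Λ * l2 χ χ)
    (a : ℝ → ℝ) {ρ γ : ℝ} (hρ : 0 ≤ ρ) (hγ : 0 ≤ γ) (hNγ : (N : ℝ) * γ ≤ 1 / 2)
    (hres : ∀ n,
      l2 (transferApply β ((transferApply (L := L) β)^[m] (liftVec β φ (ψ n / Ω₁))) -
            a (ev n) • (transferApply (L := L) β)^[m] (liftVec β φ (ψ n / Ω₁)))
          (transferApply β ((transferApply (L := L) β)^[m] (liftVec β φ (ψ n / Ω₁))) -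
            a (ev n) • (transferApply (L := L) β)^[m] (liftVec β φ (ψ n / Ω₁))) ≤
        ρ * l2 ((transferApply (L := L) β)^[m] (liftVec β φ (ψ n / Ω₁))) ((transferApply (L := L) β)^[m] (liftVec β φ (ψ n / Ω₁))))
    (hgram : ∀ n m', n ≠ m' → ev n = ev m' →
      |l2 ((transferApply (L := L) β)^[m] (liftVec β φ (ψ n / Ω₁))) ((transferApply (L := L) β)^[m] (liftVec β φ (ψ m' / Ω₁)))| ≤
        γ * (Real.sqrt (l2 ((transferApply (L := L) β)^[m] (liftVec β φ (ψ n / Ω₁))) ((transferApply (L := L) β)^[m] (liftVec β φ (ψ n / Ω₁)))) *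
          Real.sqrt (l2 ((transferApply (L := L) β)^[m] (liftVec β φ (ψ m' / Ω₁))) ((transferApply (L := L) β)^[m] (liftVec β φ (ψ m' / Ω₁))))))
    {ω : GaugeConfig 3 1 SU2 → ℝ} {g : Fin k → (GaugeConfig 3 1 SU2 → ℝ)} (hb : LiftBasis B k ω g) (i : Fin k) :
    ∃ a' : ℝ,
      l2 (transferApply β ((transferApply (L := L) β)^[m] (liftVec β φ (g i))) - a' • (transferApply (L := L) β)^[m] (liftVec β φ (g i)))
          (transferApply β ((transferApply (L := L) β)^[m] (liftVec β φ (g i))) - a' • (transferApply (L := L) β)^[m] (liftVec β φ (g i))) ≤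
        2 * N * ρ * l2 ((transferApply (L := L) β)^[m] (liftVec β φ (g i))) ((transferApply (L := L) β)^[m] (liftVec β φ (g i))) :=
  residualLaw_allBases_of_reference_lift β (fun g' => (transferApply (L := L) β)^[m] (liftVec β φ g'))
    (fun _ c hf => iterate_liftVec_sum_smul β m hφ hf c) (fun _ hg' => isPhys_iterate_liftVec β m hφ hg')
    hB k hΩ₁ hpos hψ hon ev heig hΛ hΛk hdom a hρ hγ hNγ hres hgram hb i

end Summit.QuantumFields.YangMills.Theorems.FemtoTransferGap.LiftLeak

end
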